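import Mathlib
import Literature.Computability.AlgebraicComplexity.FixedPointLog
import Summits.RiemannHypothesis.RiemannHypothesis.Theorems.WeilFormatCJointShiftSOS
import Summits.RiemannHypothesis.RiemannHypothesis.Theorems.WeilFormatCCellShiftCert
import Summits.RiemannHypothesis.RiemannHypothesis.Theorems.WeilFormatCCellShiftCertCells
import Summits.RiemannHypothesis.RiemannHypothesis.Theorems.WeilFormatCKCellCert
import HarnessLib

/-!
# k-prime cell certificate (route K3 successor): the REAL SEMANTICS of the checker data (definitions only)

Helper file (`--supports stmt-RiemannHypothesis-0098`), RH-free; seat rh-explicit-weil-1 gen7.  All noncomputable real-valued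
meanings used by the soundness proof of `WeilFormatCKCellCert.lean`, collected in ONE definitions file so that the four proof
files (`…Brackets`, `…Cells`, `…Packing`, `…Table`) and the soundness file (`…Sound`) declare no definitions:
header semantics (`phi γ = γ·ℓ`, weight `wt`, `wsum`, cell width `cw`); the cell adapter `toC : CellSOS.Cert` (reuses every
cell/piece lemma of `WeilFormatCCellShiftCertCells.lean`), pieces `piece` and correlations `X(u,k,l) = ∫ f_k(x − u) f_l(x) dx`;
packed-column semantics (`dig`, `cvec = digit − moff`, integer Gram entry `gdot`); table values (`entryVal`, `val`, `blockVal`,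
`winVal`, `tableSum`, the offsets `offs` of a part); the block Gram form (`blockFull`, `fullSum`, `diagSum`, `lowSum`, `walkFull`).
Standard axioms only.
-/

set_option linter.dupNamespace false
set_option autoImplicit false

noncomputable section

namespace Summit.RiemannHypothesis.RiemannHypothesis.Theorems.WeilFormatC

namespace KCell

open MeasureTheory Set Finset
open scoped Real BigOperators

namespace Cert

variable (c : Cert)

/-! ### Header semantics -/

/-- The real frequency of the coordinates from position `j` on: `Σ_i γ_i · log p_{j+i}`. [folklore] -/
def phiFrom (j : ℕ) : List ℤ → ℝ
  | [] => 0
  | x :: xs => (x : ℝ) * Real.log (c.pj j) + phiFrom (j + 1) xs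

/-- The real frequency `γ·ℓ`, `ℓ_j = log p_j`. [folklore] -/
def phi (γ : List ℤ) : ℝ := c.phiFrom 0 γ

/-- The weight `log p_j / √(p_j^e)` of the window item `(j, e, s, d)`. [folklore] -/
def wt (w : WItem) : ℝ := Real.log (c.pj w.1) / Real.sqrt ((c.pj w.1 : ℝ) ^ w.2.1)

/-- Sum of the weights of a list of window items. [folklore] -/
def wsum : List WItem → ℝ
  | [] => 0
  | w :: ws => c.wt w + wsum ws

/-- The cell width `2h = 2·aQ/p`. [folklore] -/
def cw : ℝ := 2 * (c.aQ : ℝ) / c.pcells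

/-! ### Cells, pieces, correlations (through the 4-prime adapter) -/

/-- The 4-prime cell header carrying our window half-width and cell count: lets us REUSE every cell/piece lemma of
`WeilFormatCCellShiftCertCells.lean`. [folklore] -/
def toC : CellSOS.Cert where
  p := (0, 0, 0, 0)
  e := (0, 0, 0, 0)
  window := []
  pcells := c.pcells
  mc := []
  kbits := c.kbits
  prec := c.prec
  terms := c.terms
  llo := (0, 0, 0, 0)
  lhi := (0, 0, 0, 0)
  wsq := []
  aQ := c.aQ
  thr := c.thr
  aden := c.aden
  nparts := 1
  dparts := []
  g0 := 0
  D := 0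

/-- `toC` carries our cell count. -/
theorem toC_pcells : c.toC.pcells = c.pcells := rfl

/-- `toC` carries our window half-width. -/
theorem toC_aQ : c.toC.aQ = c.aQ := rfl

/-- `toC` has our cell width. -/
theorem toC_cw : c.toC.cw = c.cw := rfl

/-- The piece `f_k = f · 1_{cell k}` (cells of width `2aQ/p` tiling `[−aQ, aQ]`). [folklore] -/
def piece (f : ℝ → ℝ) (k : ℕ) : ℝ → ℝ := c.toC.piece f k

/-- The correlation of two pieces at a real shift: `X(u,k,l) = ∫ f_k(x − u) f_l(x) dx`. [folklore] -/
def X (f : ℝ → ℝ) (u : ℝ) (k l : ℕ) : ℝ := ∫ x, c.piece f k (x - u) * c.piece f l x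

/-! ### Packed-column semantics -/

/-- digit `t` of the packed column `q` (as an integer). [folklore] -/
def dig (q : PCol) (t : ℕ) : ℤ := ((digits c.W c.rank q.1).getD t 0 : ℤ)

/-- The Gram vector entry `t` of the packed column `q`: `digit_t − moff`. [folklore] -/
def cvec (q : PCol) (t : ℕ) : ℤ := c.dig q t - c.moff

/-- The integer Gram entry of two packed columns: `Σ_{t<r} c_t c'_t`. [folklore] -/
def gdot (q q' : PCol) : ℤ := ∑ t ∈ Finset.range c.rank, c.cvec q t * c.cvec q' t

/-! ### Values of class tables -/

section Values

variable (f : ℝ → ℝ)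

/-- The real value of one entry: `Σ_{k,l<p} (2·m_{kl}/4^kbits + 2·Σwt) · X(γ·ℓ, k, l)`. [folklore] -/
def entryVal (en : Entry) : ℝ :=
  ∑ k ∈ Finset.range c.pcells, ∑ l ∈ Finset.range c.pcells,
    (2 * (c.mass (mget en.2.1 k l) : ℝ) / (4 : ℝ) ^ c.kbits + 2 * c.wsum en.2.2) * c.X f (c.phi en.1) k l

/-- The real value of a class table. [folklore] -/
def val : List Entry → ℝ
  | [] => 0
  | en :: rest => c.entryVal f en + val rest

/-- The value of a block pair (later `bL`, earlier `bE`). [folklore] -/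
def blockVal (bL bE : Block) : ℝ := c.entryVal f (vsub bL.1 bE.1, c.mmat bL.2 bE.2, [])

/-- The window value of item `w` when accounted at offset `d`. [folklore] -/
def winVal (d : ℕ) (w : WItem) : ℝ := if w.2.2.2 = d then c.entryVal f (c.uvec w.1 w.2.1, c.zmat, [w]) else 0

end Values

/-- Plain sum of the entry bounds of a table. [folklore] -/
def tableSum : List Entry → ℚ
  | [] => 0
  | en :: rest => c.entryBound en + tableSum rest

/-- The offsets of part `j` up to `n`: `{d ≤ n : 1 ≤ d, d ≡ j (mod nparts)}`. [folklore] -/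
def offs (j n : ℕ) : Finset ℕ := (Finset.range (n + 1)).filter fun d ↦ 1 ≤ d ∧ d % c.nparts = j

/-! ### The block Gram form -/

section BlockForm

variable (f : ℝ → ℝ)

/-- The full Gram term of an ORDERED block pair: `Σ_{k,l<p} (⟨c_{a,k}, c_{b,l}⟩/4^kbits) · X(S_a·ℓ − S_b·ℓ, k, l)`. -/
def blockFull (a b : Block) : ℝ :=
  ∑ k ∈ Finset.range c.pcells, ∑ l ∈ Finset.range c.pcells,
    ((c.gdot (col a.2 k) (col b.2 l) : ℤ) : ℝ) / (4 : ℝ) ^ c.kbits * c.X f (c.phi a.1 - c.phi b.1) k l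

/-- The full double sum over a block list. -/
def fullSum (L : List Block) : ℝ := (L.map fun a ↦ (L.map fun b ↦ c.blockFull f a b).sum).sum

/-- The diagonal. -/
def diagSum : List Block → ℝ
  | [] => 0
  | a :: rest => c.blockFull f a a + diagSum rest

/-- The strict lower triangle: pairs (later, earlier). -/
def lowSum : List Block → ℝ
  | [] => 0
  | a :: rest => (rest.map fun x ↦ c.blockFull f x a).sum + lowSum rest

/-- The offset-`d` walk of the full terms: `Σ_i blockFull L[i+d] L[i]`. -/
def walkFull (L : List Block) (d : ℕ) : ℝ := (List.zipWith (fun x y ↦ c.blockFull f x y) (L.drop d) L).sum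

end BlockForm

end Cert

end KCell

end Summit.RiemannHypothesis.RiemannHypothesis.Theorems.WeilFormatC
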